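import Summits.ABC.ABC.Theorems.PlacewiseSzpiroSingleTowerSzpiroBakerSinglePlace
import Literature.NumberTheory.DiophantineGeometry.AbcValuationProductFreyDataProofs
import Literature.NumberTheory.DiophantineGeometry.MinimalDiscriminantFactorizationProofs
import HarnessLib

/-!
# Route PlacewiseSzpiro, crux `SingleTowerSzpiro` (stmt-ABC-22410), line `birth`:
# the first deliverable ON THE FREY LOCUS AT THE SMALL PRIMES (proved modulo Matveev + Yu)

Summits-side helper (theorems only; no definition, no named fact, no `Theses` import), sequel of
`PlacewiseSzpiroSingleTowerSzpiroBakerSinglePlace.lean` (the Baker method per place: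
`ν_p(abc) · log p ≤ C(η) · p · rad(abc)^η`). Here that bound is translated into the currency of the registered
stub `stub_firstDeliverable_towerBelowStewartYu` of the line — towers `ord_v(Δ_min(E)) · log p_v` against the
conductor `N_E` — for the elliptic curves where an `S`-unit equation over `ℚ` is available: the Frey–Hellegouarch
curves `W = freyCurve a b : y² = x(x − a)(x + b)` of abc triples `a + b = c` (tree data, Pasten JNT 254 §3 / §16.4:
`v_q(Δ_min(W)) = 2 v_q(abc)` at odd `q`, `N_W ∣ 2⁸ rad(abc)`, odd `q ∣ abc ⇒ q ∣ N_W`):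

* `rad_le_two_mul_conductorNorm_freyCurve` — `rad(abc) ≤ 2 N_W`;
* **`exists_frey_tower_le_of_natGenerator_le`** — for every `δ > 0` there is `C > 0` such that for every abc triple
  and every place `v ∤ 2` with `p_v ≤ N_W^{1/3 − 2δ}`:
  **`ord_v(Δ_min(W)) · log p_v ≤ C · N_W^{1/3 − δ}`** — the registered first deliverable, verbatim in shape,
  RESTRICTED to (Frey locus, odd places below `N^{1/3−2δ}`), conditional on `PastenApproximationBound K`
  (Matveev + Yu 2007 over `ℚ`, the trust base of `Literature.Barriers.ABC.BakerMethodBounds`);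
* `exists_frey_tower_le_mul_rpow` — the `η`-form: `ord_v(Δ_min(W)) · log p_v ≤ C(η) · p_v · N_W^η` at every odd place
  (so at a FIXED odd prime the Frey tower is `≪_η N^η`; the crux asks `≤ (6+ε) log N + C`);
* `…_of_evertseGyory` — the same from the tree's one named fact `evertseGyory_thm_4_2_1_rat`, together with the
  abc-triple forms of the previous file.

Why only this much (lead's census, `Cruxes/SingleTowerSzpiro/Lines/birth.md` rev 5): over ALL `E/ℚ` the first
deliverable is `∃ α < 1/3, SzpiroEpsShape α` (`PlacewiseSzpiroSingleTowerSzpiroFirstDeliverableCalib.lean`), open and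
beyond `BakerMethodBounds`; at the LARGE primes (`p > N^{1/3}`) even on the Frey locus nothing below Stewart–Yu is
known (the place bound carries the factor `p`); a general `E/ℚ` has its `S`-unit equation `λ + (1−λ) = 1` only over
`ℚ(E[2])`, where the `S`-regulator costs a power of `N_E`. HONESTY: no summit, rung or stub is proved; the crux and
A1′/A-PS are NOT abc; conditional ≠ proved; typed ≠ proved.
-/

noncomputable section

-- `Summit.<Summit>.<Problem>` is the mandated summit-side namespace (CONVENTIONS §2); for the
-- single-conjunct summit `ABC` the two coincide, so the duplicate `ABC.ABC` is deliberate.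
set_option linter.dupNamespace false

namespace Summit.ABC.ABC.Theorems.SingleTowerSzpiroLine

open Finset IsDedekindDomain
open Literature.NumberTheory.DiophantineGeometry
open Literature.NumberTheory.DiophantineGeometry.Dioph
open Literature.NumberTheory.EllipticCurves
open Literature.Barriers.ABC

/-! ### The abc-triple forms from the named fact -/

/-- **The single-place bound from the tree's one named fact** `evertseGyory_thm_4_2_1_rat`
(Evertse–Győry Thm 4.2.1 over `ℚ`, which gives `PastenApproximationBound pastenK`, `pasten2024_thm_2_1`):
`ν_p(abc) · log p ≤ C(η) · p · rad(abc)^η`. [folklore] -/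
theorem exists_single_place_bound_of_evertseGyory (h : evertseGyory_thm_4_2_1_rat) {η : ℝ} (hη : 0 < η) :
    ∃ C : ℝ, 0 < C ∧ ∀ a b c : ℕ, IsABCTriple a b c → ∀ p : ℕ, p.Prime → p ∣ a * b * c →
      ((a * b * c).factorization p : ℝ) * Real.log p ≤ C * p * (rad a b c : ℝ) ^ η :=
  exists_single_place_bound_of_approximationBound one_le_pastenK (pasten2024_thm_2_1 h) hη

/-- **Below Stewart–Yu at the small primes, from the named fact** `evertseGyory_thm_4_2_1_rat`. [folklore] -/
theorem exists_single_place_bound_below_stewartYu_of_evertseGyory (h : evertseGyory_thm_4_2_1_rat)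
    {δ : ℝ} (hδ : 0 < δ) :
    ∃ C : ℝ, 0 < C ∧ ∀ a b c : ℕ, IsABCTriple a b c → ∀ p : ℕ, p.Prime → p ∣ a * b * c →
      (p : ℝ) ≤ (rad a b c : ℝ) ^ ((1 : ℝ) / 3 - 2 * δ) →
      ((a * b * c).factorization p : ℝ) * Real.log p ≤ C * (rad a b c : ℝ) ^ ((1 : ℝ) / 3 - δ) :=
  exists_single_place_bound_below_stewartYu_of_approximationBound one_le_pastenK (pasten2024_thm_2_1 h) hδ

/-! ### Frey–Hellegouarch curves: radical versus conductor, towers versus `ν_p(abc)` -/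

/-- **`rad(abc) ≤ 2 · N_W`** for the Frey curve `W` of an abc triple: every odd prime of `abc` divides `N_W`
(`IsABCTriple.dvd_conductorNorm_freyCurve`), so `∏_{q ∣ abc, q odd} q ∣ N_W`, and `rad(abc) ∣ 2 · ∏_{q odd} q`.
[folklore] -/
theorem rad_le_two_mul_conductorNorm_freyCurve {a b c : ℕ} (ht : IsABCTriple a b c) :
    (rad a b c : ℝ) ≤ 2 * (((freyCurve (a : ℤ) (b : ℤ)).conductorNorm ℤ : ℕ) : ℝ) := by
  haveI := ht.freyCurve_isElliptic
  have hNpos : 0 < (freyCurve (a : ℤ) (b : ℤ)).conductorNorm ℤ :=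
    WeierstrassCurve.conductorNorm_pos_holds _
  have hprod : ∏ q ∈ (a * b * c).primeFactors.erase 2, q ∣ (freyCurve (a : ℤ) (b : ℤ)).conductorNorm ℤ := by
    refine Finset.prod_primes_dvd _
      (fun q hq => (Nat.prime_of_mem_primeFactors (Finset.mem_of_mem_erase hq)).prime) fun q hq => ?_
    have hq' := Finset.mem_erase.mp hq
    have hqp : q.Prime := Nat.prime_of_mem_primeFactors hq'.2
    exact ht.dvd_conductorNorm_freyCurve hqp hq'.1 (Nat.dvd_of_mem_primeFactors hq'.2)
  have hle : ∏ q ∈ (a * b * c).primeFactors.erase 2, q ≤ (freyCurve (a : ℤ) (b : ℤ)).conductorNorm ℤ :=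
    Nat.le_of_dvd hNpos hprod
  have hrad : rad a b c ≤ 2 * ∏ q ∈ (a * b * c).primeFactors.erase 2, q := by
    rw [rad_def, Nat.radical_eq_prod_primeFactors]
    by_cases h2 : 2 ∈ (a * b * c).primeFactors
    · rw [← Finset.mul_prod_erase _ _ h2]
    · rw [Finset.erase_eq_of_notMem h2]
      exact Nat.le_mul_of_pos_left _ two_pos
  have h3 : rad a b c ≤ 2 * (freyCurve (a : ℤ) (b : ℤ)).conductorNorm ℤ :=
    hrad.trans (Nat.mul_le_mul_left 2 hle)
  exact_mod_cast h3

/-- **The tower of the Frey curve at an odd place is `2 ν_p(abc) · log p`** (`p = p_v`):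
`ord_v(Δ_min(W)) = v_p(|Δ_min|)` (`WeierstrassCurve.factorization_minimalDiscriminantNorm_holds`) and
`v_p(Δ_min(W)) = 2 v_p(abc)` at odd `p` (`IsABCTriple.factorization_minimalDiscriminantNorm_freyCurve`). [folklore] -/
theorem frey_tower_eq {a b c : ℕ} (ht : IsABCTriple a b c) (v : HeightOneSpectrum ℤ)
    (hv : Rat.HeightOneSpectrum.natGenerator v ≠ 2) :
    ((freyCurve (a : ℤ) (b : ℤ)).ordMinimalDiscriminant v : ℝ) *
        Real.log (Rat.HeightOneSpectrum.natGenerator v : ℝ) =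
      2 * (((a * b * c).factorization (Rat.HeightOneSpectrum.natGenerator v) : ℝ) *
        Real.log (Rat.HeightOneSpectrum.natGenerator v : ℝ)) := by
  have hp : (Rat.HeightOneSpectrum.natGenerator v).Prime := Rat.HeightOneSpectrum.prime_natGenerator v
  have h1 := WeierstrassCurve.factorization_minimalDiscriminantNorm_holds (freyCurve (a : ℤ) (b : ℤ)) v
  have h2 := ht.factorization_minimalDiscriminantNorm_freyCurve hp hv
  rw [← h1, h2]
  push_cast
  ring

/-! ### The first deliverable on the Frey locus at the small primes -/

/-- **`η`-form: the Frey tower at an odd place is `≤ C(η) · p_v · N_W^η`.** For every `η > 0` there is `C > 0`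
with `ord_v(Δ_min(W)) · log p_v ≤ C · p_v · N_W^η` for every abc triple (`W` its Frey curve) and every place `v ∤ 2`
(`2 ν_p(abc) log p ≤ 2 C₁ p rad^η ≤ 2 C₁ 2^η p N^η`, `rad ≤ 2N`). Conditional on `PastenApproximationBound K`.
At a FIXED odd prime this is `≪_η N_W^η` — to be compared with the crux's `(6+ε) log N_E + C`. [folklore] -/
theorem exists_frey_tower_le_mul_rpow {K : ℝ} (hK : 1 ≤ K) (hP : PastenApproximationBound K)
    {η : ℝ} (hη : 0 < η) :
    ∃ C : ℝ, 0 < C ∧ ∀ a b c : ℕ, IsABCTriple a b c → ∀ v : HeightOneSpectrum ℤ,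
      Rat.HeightOneSpectrum.natGenerator v ≠ 2 →
      ((freyCurve (a : ℤ) (b : ℤ)).ordMinimalDiscriminant v : ℝ) *
          Real.log (Rat.HeightOneSpectrum.natGenerator v : ℝ) ≤
        C * (Rat.HeightOneSpectrum.natGenerator v : ℝ) *
          (((freyCurve (a : ℤ) (b : ℤ)).conductorNorm ℤ : ℕ) : ℝ) ^ η := by
  obtain ⟨C₁, hC₁0, hC₁⟩ := exists_single_place_bound_of_approximationBound hK hP hη
  refine ⟨2 * (2 : ℝ) ^ η * C₁, by positivity, fun a b c ht v hv => ?_⟩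
  haveI := ht.freyCurve_isElliptic
  set p : ℕ := Rat.HeightOneSpectrum.natGenerator v with hpdef
  have hp : p.Prime := Rat.HeightOneSpectrum.prime_natGenerator v
  have hN1 : (1 : ℝ) ≤ (((freyCurve (a : ℤ) (b : ℤ)).conductorNorm ℤ : ℕ) : ℝ) := by
    exact_mod_cast WeierstrassCurve.conductorNorm_pos_holds (freyCurve (a : ℤ) (b : ℤ))
  set N : ℝ := (((freyCurve (a : ℤ) (b : ℤ)).conductorNorm ℤ : ℕ) : ℝ) with hNdef
  have hN0 : (0 : ℝ) ≤ N := by linarith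
  have hp0 : (0 : ℝ) ≤ p := by exact_mod_cast hp.pos.le
  have hRN : (rad a b c : ℝ) ≤ 2 * N := rad_le_two_mul_conductorNorm_freyCurve ht
  have hR0 : (0 : ℝ) ≤ (rad a b c : ℝ) := by positivity
  have hRη : (rad a b c : ℝ) ^ η ≤ (2 : ℝ) ^ η * N ^ η := by
    rw [← Real.mul_rpow (by norm_num) hN0]
    exact Real.rpow_le_rpow hR0 hRN hη.le
  rw [frey_tower_eq ht v hv]
  by_cases hpabc : p ∣ a * b * c
  · have h := hC₁ a b c ht p hp hpabc
    calc 2 * (((a * b * c).factorization p : ℝ) * Real.log p) ≤ 2 * (C₁ * p * (rad a b c : ℝ) ^ η) := by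
          linarith
      _ ≤ 2 * (C₁ * p * ((2 : ℝ) ^ η * N ^ η)) := by gcongr
      _ = 2 * (2 : ℝ) ^ η * C₁ * p * N ^ η := by ring
  · have h0 : (a * b * c).factorization p = 0 := Nat.factorization_eq_zero_of_not_dvd hpabc
    rw [h0]
    push_cast
    rw [zero_mul, mul_zero]
    positivity

/-- **The first deliverable on the Frey locus at the small primes** (PROVED modulo Matveev + Yu): for every
`δ > 0` there is `C > 0` such that for every abc triple `a + b = c`, its Frey–Hellegouarch curve
`W : y² = x(x − a)(x + b)`, and every place `v ∤ 2` with `p_v ≤ N_W^{1/3 − 2δ}`: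

  `ord_v(Δ_min(W)) · log p_v ≤ C · N_W^{1/3 − δ}`

— the shape of the registered stub `stub_firstDeliverable_towerBelowStewartYu`, restricted to the locus and the
primes where the Baker method produces it (`exists_frey_tower_le_mul_rpow` at `η = δ`:
`C p N^δ ≤ C N^{1/3−2δ} N^δ`). Strictly below the Stewart–Yu scale `N^{1/3}(log N)³` of `log|Δ_min(W)|`; vacuous for
`δ ≥ 1/6`. Conditional on `PastenApproximationBound K` (`K ≥ 1`). [folklore] -/
theorem exists_frey_tower_le_of_natGenerator_le {K : ℝ} (hK : 1 ≤ K) (hP : PastenApproximationBound K)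
    {δ : ℝ} (hδ : 0 < δ) :
    ∃ C : ℝ, 0 < C ∧ ∀ a b c : ℕ, IsABCTriple a b c → ∀ v : HeightOneSpectrum ℤ,
      Rat.HeightOneSpectrum.natGenerator v ≠ 2 →
      (Rat.HeightOneSpectrum.natGenerator v : ℝ) ≤
        (((freyCurve (a : ℤ) (b : ℤ)).conductorNorm ℤ : ℕ) : ℝ) ^ ((1 : ℝ) / 3 - 2 * δ) →
      ((freyCurve (a : ℤ) (b : ℤ)).ordMinimalDiscriminant v : ℝ) *
          Real.log (Rat.HeightOneSpectrum.natGenerator v : ℝ) ≤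
        C * (((freyCurve (a : ℤ) (b : ℤ)).conductorNorm ℤ : ℕ) : ℝ) ^ ((1 : ℝ) / 3 - δ) := by
  obtain ⟨C, hC0, hC⟩ := exists_frey_tower_le_mul_rpow hK hP hδ
  refine ⟨C, hC0, fun a b c ht v hv hple => ?_⟩
  haveI := ht.freyCurve_isElliptic
  have h := hC a b c ht v hv
  have hN1 : (1 : ℝ) ≤ (((freyCurve (a : ℤ) (b : ℤ)).conductorNorm ℤ : ℕ) : ℝ) := by
    exact_mod_cast WeierstrassCurve.conductorNorm_pos_holds (freyCurve (a : ℤ) (b : ℤ))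
  set N : ℝ := (((freyCurve (a : ℤ) (b : ℤ)).conductorNorm ℤ : ℕ) : ℝ) with hNdef
  have hN0 : (0 : ℝ) < N := by linarith
  have hNδ : 0 ≤ N ^ δ := Real.rpow_nonneg hN0.le _
  calc ((freyCurve (a : ℤ) (b : ℤ)).ordMinimalDiscriminant v : ℝ) *
          Real.log (Rat.HeightOneSpectrum.natGenerator v : ℝ)
      ≤ C * (Rat.HeightOneSpectrum.natGenerator v : ℝ) * N ^ δ := h
    _ ≤ C * N ^ ((1 : ℝ) / 3 - 2 * δ) * N ^ δ :=
        mul_le_mul_of_nonneg_right (mul_le_mul_of_nonneg_left hple hC0.le) hNδ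
    _ = C * N ^ ((1 : ℝ) / 3 - δ) := by
        rw [mul_assoc, ← Real.rpow_add hN0]; ring_nf

/-- **The first deliverable on the Frey locus at the small primes, from the named fact**
`evertseGyory_thm_4_2_1_rat` (Evertse–Győry Thm 4.2.1 over `ℚ`: Matveev + Yu 2007). [folklore] -/
theorem exists_frey_tower_le_of_natGenerator_le_of_evertseGyory (h : evertseGyory_thm_4_2_1_rat)
    {δ : ℝ} (hδ : 0 < δ) :
    ∃ C : ℝ, 0 < C ∧ ∀ a b c : ℕ, IsABCTriple a b c → ∀ v : HeightOneSpectrum ℤ,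
      Rat.HeightOneSpectrum.natGenerator v ≠ 2 →
      (Rat.HeightOneSpectrum.natGenerator v : ℝ) ≤
        (((freyCurve (a : ℤ) (b : ℤ)).conductorNorm ℤ : ℕ) : ℝ) ^ ((1 : ℝ) / 3 - 2 * δ) →
      ((freyCurve (a : ℤ) (b : ℤ)).ordMinimalDiscriminant v : ℝ) *
          Real.log (Rat.HeightOneSpectrum.natGenerator v : ℝ) ≤
        C * (((freyCurve (a : ℤ) (b : ℤ)).conductorNorm ℤ : ℕ) : ℝ) ^ ((1 : ℝ) / 3 - δ) :=
  exists_frey_tower_le_of_natGenerator_le one_le_pastenK (pasten2024_thm_2_1 h) hδ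

/-- **`η`-form from the named fact.** [folklore] -/
theorem exists_frey_tower_le_mul_rpow_of_evertseGyory (h : evertseGyory_thm_4_2_1_rat)
    {η : ℝ} (hη : 0 < η) :
    ∃ C : ℝ, 0 < C ∧ ∀ a b c : ℕ, IsABCTriple a b c → ∀ v : HeightOneSpectrum ℤ,
      Rat.HeightOneSpectrum.natGenerator v ≠ 2 →
      ((freyCurve (a : ℤ) (b : ℤ)).ordMinimalDiscriminant v : ℝ) *
          Real.log (Rat.HeightOneSpectrum.natGenerator v : ℝ) ≤
        C * (Rat.HeightOneSpectrum.natGenerator v : ℝ) *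
          (((freyCurve (a : ℤ) (b : ℤ)).conductorNorm ℤ : ℕ) : ℝ) ^ η :=
  exists_frey_tower_le_mul_rpow one_le_pastenK (pasten2024_thm_2_1 h) hη

end Summit.ABC.ABC.Theorems.SingleTowerSzpiroLine

end
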